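import Summits.HodgeConjecture.CorCM.ParallelShadowsCapacity
import Summits.HodgeConjecture.CorCM.CommonQuarticCMSubfieldFourfolds
import Literature.AlgebraicGeometry.Pohlmann1968.WeilTypeCMSubfieldRankBound
import Literature.NumberTheory.ComplexMultiplication.CMTypeCount
import HarnessLib

/-!
# CAPACITY of a common CM subfield: more than `[k:ℚ]/2` CM fields quadratic over one CM field `k` never carry a
# nondegenerate family — three simple CM fourfolds through one quartic CM field always have an exceptional class

COR-CM (cell `pub-hodgecm2`, binder seat `b16` gen 49, count-neutral claim PARSHADOW, file F6 — number-field dress of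
`ParallelShadowsCapacity` (F5); theorems only, no definition, no named fact, no `sorry`).  NEW as stated, hence under
`Summits/`.  HONEST FRAMING: rank statements and EXCEPTIONAL (outside `D• ⊗ ℂ`) Hodge classes on products of CM abelian
varieties, not claimed algebraic or not; `HC_CM` is neither used nor asserted.

SETTING.  CM fields `K_i` (`i ∈ I`) all receiving one CM field `k` (`e_i : k → K_i`), CM types `Φ_i`, signatures
`n_i(z) = #{φ ∈ Φ_i | φ ∘ e_i = z}` over the places `z : k → ℂ`, fibres `f_i(z) = #{φ | φ ∘ e_i = z} = [K_i : k]`, shadows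
`c_i = 2 n_i − f_i` (odd functions on `Hom(k, ℂ)`, a space of dimension `[k:ℚ]/2`).

> **Capacity** (`not_isNondegenerateFamily_of_card_lt_of_shadows_ne_zero`).  If more than `[k:ℚ]/2` slots have a
> NON-ZERO shadow on `k`, the family is degenerate: `cmFamilyRank Φ + |I| < Σ_i cmTypeRank Φ_i + 1`.

> **Quadratic steps, unconditionally in the types** (`not_isNondegenerateFamily_of_card_lt_of_quadratic`).  If more than
> `[k:ℚ]/2` of the `K_i` are QUADRATIC over `k`, EVERY family of CM types on `(K_i)` is degenerate: a slot with zero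
> shadow is balanced over `k` (signature `(1,1)` at every place), hence itself degenerate of Weil type relative to `k`
> (Yanai's bound, tree `cmTypeRank_add_finrank_div_two_le_of_fibres_balanced`: `rank ≤ [K:ℚ]/2 + 1 − [k:ℚ]/2`), and
> otherwise the capacity bound applies.  On abelian varieties (`exists_exceptional_prod_of_isSimple_of_card_lt_of_quadratic`):
> SIMPLE, pairwise NON-ISOGENOUS realisations carry an exceptional Hodge class on some product of powers.  Likewise for
> ODD relative degrees `[K_i : k]` (`not_isNondegenerateFamily_of_card_lt_of_odd`: there every shadow is non-zero).

THE `(4,4,4)` CELL (`exists_exceptional_prod_three_fourfolds_of_common_quartic`): **three simple, pairwise non-isogenous CM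
abelian fourfolds whose octic CM fields contain a common quartic CM field always carry an exceptional Hodge class on some
`F₀^a × F₁^b × F₂^c`** — whatever the fields and the types (capacity `2 = [k:ℚ]/2`).  Compare the tree's "at most two
simple CM abelian surfaces per dihedral Galois closure" (`CMTypeRankEvaluationCriterion.card_le_finrank_of_forall_map_slotExt_le`
with `dim V = 2`); files F3/F4 decide the PAIRS over a common quartic CM field with a common unsplit place.

## References

* [Mai1989] L. Mai, *Lower bounds for the ranks of CM types*, J. Number Theory 32 (1989), §2 Prop. 1 (proof).
* [Gordon1999HodgeAVSurvey] B. B. Gordon, *A survey of the Hodge conjecture for abelian varieties*, 7.4–7.7, 9.4.3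
  (Yanai's theorem).
* [Shimura1998] G. Shimura, *Abelian Varieties with Complex Multiplication and Modular Functions*, §18.1.
-/

set_option autoImplicit false

noncomputable section

open scoped BigOperators
open CategoryTheory CategoryTheory.Limits NumberField NumberField.ComplexEmbedding Module

namespace Summit.HodgeConjecture.CorCM

open Literature.NumberTheory.ComplexMultiplication
open Literature.AlgebraicGeometry.Motives (AbelianVariety CMType)
open Literature.AlgebraicGeometry.HodgeTheory
open Literature.AlgebraicGeometry.ComplexMultiplication (IsCMTypeRealisation)
open Literature.AlgebraicGeometry.VanGeemen1994 (hodgeClassSpan)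
open Literature.AlgebraicGeometry.Pohlmann1968
open Literature.Barriers.HodgeConjecture (divisorClassesSpan)
open scoped Classical

variable {I : Type} {K : I → Type} [∀ i, Field (K i)] [∀ i, NumberField (K i)] [∀ i, IsCMField (K i)] [Fintype I]
  [Nonempty I]
variable {k : Type} [Field k] [NumberField k] [IsCMField k]

/-! ### §1 Capacity: more than `[k:ℚ]/2` slots with non-zero shadow -/

section Capacity

/-- **Capacity of a common CM subfield.**  If more than `[k:ℚ]/2` slots `i ∈ S` have a non-zero shadow on `k`
(`2 n_i(z_i) ≠ f_i(z_i)` for some place `z_i`), then `cmFamilyRank Φ + |I| < Σ_i cmTypeRank Φ_i + 1`.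
[cite: Mai1989, §2 Prop. 1 (proof)] [cite: Gordon1999HodgeAVSurvey, 7.5–7.7] -/
theorem cmFamilyRank_add_card_lt_of_card_lt_of_shadows_ne_zero (e : ∀ i, k →+* K i) (Φ : ∀ i, CMType (K i))
    (S : Finset I) (hS : finrank ℚ k / 2 < S.card)
    (hne : ∀ i ∈ S, ∃ z : k →+* ℂ,
      2 * (Finset.univ.filter fun φ : K i →+* ℂ => φ.comp (e i) = z ∧ φ ∈ (Φ i).1).card ≠
        (Finset.univ.filter fun φ : K i →+* ℂ => φ.comp (e i) = z).card) :
    CMAlgebra.cmFamilyRank Φ + Fintype.card I < (∑ i, cmTypeRank (Φ i)) + 1 := by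
  obtain ⟨S₁⟩ : Nonempty (CMType k) := CMTypeCount.nonempty_cmType_iff_isTotallyComplex.2 inferInstance
  have hcard : Fintype.card (k →+* ℂ) / 2 < S.card := by rwa [Embeddings.card k ℂ]
  refine Shadow.typeRank_sigmaType_add_card_lt_of_card_lt (G := ℂ ≃+* ℂ) (Φ := fun i => (Φ i).1)
    (fun i => isCMTypeWith_conj (Φ i)) (isCMTypeWith_conj S₁) (fun i (φ : K i →+* ℂ) => φ.comp (e i))
    (fun _ _ _ => rfl) S hcard fun i hi => ?_
  obtain ⟨z, hz⟩ := hne i hi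
  refine ⟨z, ?_⟩
  rw [shadow_eq_two_mul_card_sub_card (Φ i) (e i) z]
  intro h
  apply hz
  have h' : (2 * ((Finset.univ.filter fun φ : K i →+* ℂ => φ.comp (e i) = z ∧ φ ∈ (Φ i).1).card : ℚ)) =
      ((Finset.univ.filter fun φ : K i →+* ℂ => φ.comp (e i) = z).card : ℚ) := sub_eq_zero.1 h
  exact_mod_cast h'

/-- **… hence the family is DEGENERATE.** [cite: Gordon1999HodgeAVSurvey, 7.5–7.7] -/
theorem not_isNondegenerateFamily_of_card_lt_of_shadows_ne_zero (e : ∀ i, k →+* K i) (Φ : ∀ i, CMType (K i))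
    (S : Finset I) (hS : finrank ℚ k / 2 < S.card)
    (hne : ∀ i ∈ S, ∃ z : k →+* ℂ,
      2 * (Finset.univ.filter fun φ : K i →+* ℂ => φ.comp (e i) = z ∧ φ ∈ (Φ i).1).card ≠
        (Finset.univ.filter fun φ : K i →+* ℂ => φ.comp (e i) = z).card) :
    ¬ CMAlgebra.IsNondegenerateFamily Φ :=
  not_isNondegenerateFamily_of_cmFamilyRank_add_card_lt Φ
    (cmFamilyRank_add_card_lt_of_card_lt_of_shadows_ne_zero e Φ S hS hne)

end Capacity

/-! ### §1b Odd relative degree: every shadow is non-zero, so no hypothesis on the types is needed -/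

section OddDegree

omit [Fintype I] [Nonempty I] [∀ i, IsCMField (K i)] [IsCMField k] in
/-- Over a step of ODD relative degree `[K:k]` every shadow is non-zero: `2 n(z) ≠ f(z)` since `f(z) = [K:k]` is odd.
[cite: Shimura1998, §18.1] -/
theorem two_mul_card_ne_card_of_odd {i : I} (e : k →+* K i) (hodd : Odd (finrank ℚ (K i) / finrank ℚ k))
    (Φ : CMType (K i)) (z : k →+* ℂ) :
    2 * (Finset.univ.filter fun φ : K i →+* ℂ => φ.comp e = z ∧ φ ∈ Φ.1).card ≠
      (Finset.univ.filter fun φ : K i →+* ℂ => φ.comp e = z).card := by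
  have h := card_filter_comp_eq_mul_finrank e z
  have hk : 0 < finrank ℚ k := finrank_pos
  have hf : (Finset.univ.filter fun φ : K i →+* ℂ => φ.comp e = z).card = finrank ℚ (K i) / finrank ℚ k := by
    rw [← h, Nat.mul_div_cancel _ hk]
  intro heq
  rw [hf] at heq
  obtain ⟨m, hm⟩ := hodd
  omega

/-- **Odd relative degrees beyond the capacity: every family is degenerate.**  If more than `[k:ℚ]/2` of the CM fields
`K_i` (`i ∈ S`) have ODD relative degree `[K_i : k]` over the common CM field `k`, EVERY family of CM types on `(K_i)`
is degenerate (all their shadows are non-zero at every place).  For `k` imaginary quadratic (capacity `1`) this is the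
tree's `not_isNondegenerateFamily_of_shared_quadratic_of_odd`; e.g. three CM fields of degree `12` cubic over one
quartic CM field. [cite: Mai1989, §2 Prop. 1 (proof)] [cite: Gordon1999HodgeAVSurvey, 7.5–7.7] -/
theorem not_isNondegenerateFamily_of_card_lt_of_odd (e : ∀ i, k →+* K i) (Φ : ∀ i, CMType (K i)) (S : Finset I)
    (hS : finrank ℚ k / 2 < S.card) (hodd : ∀ i ∈ S, Odd (finrank ℚ (K i) / finrank ℚ k)) :
    ¬ CMAlgebra.IsNondegenerateFamily Φ := by
  obtain ⟨z₀⟩ : Nonempty (k →+* ℂ) := inferInstance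
  exact not_isNondegenerateFamily_of_card_lt_of_shadows_ne_zero e Φ S hS fun i hi =>
    ⟨z₀, two_mul_card_ne_card_of_odd (e i) (hodd i hi) (Φ i) z₀⟩

end OddDegree

/-! ### §2 Quadratic steps: a zero shadow is a Weil-type member, so no hypothesis on the types is needed -/

section Quadratic

omit [Fintype I] [Nonempty I] [∀ i, IsCMField (K i)] [NumberField k] [IsCMField k] in
/-- Counting through `Set.ncard`: `#{φ | φ ∘ e = z ∧ φ ∈ Φ}` as a set and as a filter. [folklore] -/
theorem ncard_setOf_comp_eq_and_mem {i : I} (e : k →+* K i) (Φ : CMType (K i)) (z : k →+* ℂ) :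
    {φ : K i →+* ℂ | φ.comp e = z ∧ φ ∈ Φ.1}.ncard =
      (Finset.univ.filter fun φ : K i →+* ℂ => φ.comp e = z ∧ φ ∈ Φ.1).card := by
  rw [Set.ncard_eq_toFinset_card', Set.toFinset_setOf]

omit [Fintype I] [Nonempty I] [∀ i, IsCMField (K i)] [IsCMField k] in
/-- Over a quadratic step a ZERO shadow means balanced fibres: if `2 n(z) = f(z)` (`= 2`) for every place then
`#{φ ∈ Φ | φ ∘ e = z} = #{φ ∉ Φ | φ ∘ e = z}` (`= 1`). [cite: Shimura1998, §18.1] -/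
theorem fibres_balanced_of_shadow_eq_zero {i : I} (e : k →+* K i) (h2 : finrank ℚ (K i) = 2 * finrank ℚ k)
    (Φ : CMType (K i))
    (hzero : ∀ z : k →+* ℂ, 2 * (Finset.univ.filter fun φ : K i →+* ℂ => φ.comp e = z ∧ φ ∈ Φ.1).card =
      (Finset.univ.filter fun φ : K i →+* ℂ => φ.comp e = z).card) (z : k →+* ℂ) :
    {φ : K i →+* ℂ | φ.comp e = z ∧ φ ∈ Φ.1}.ncard = {φ : K i →+* ℂ | φ.comp e = z ∧ φ ∉ Φ.1}.ncard := by
  rw [ncard_setOf_comp_eq_and_mem, Set.ncard_eq_toFinset_card', Set.toFinset_setOf]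
  have hsplit := Finset.card_filter_add_card_filter_not
    (s := Finset.univ.filter fun φ : K i →+* ℂ => φ.comp e = z) (fun φ : K i →+* ℂ => φ ∈ Φ.1)
  rw [Finset.filter_filter, Finset.filter_filter, card_filter_comp_eq_two e h2 z] at hsplit
  have hz := hzero z
  rw [card_filter_comp_eq_two e h2 z] at hz
  omega

omit [Fintype I] [Nonempty I] in
/-- **A type with zero shadow over a quadratic step is DEGENERATE** (balanced over the CM subfield `k`: Yanai's bound
`rank(Φ) + [k:ℚ]/2 ≤ [K:ℚ]/2 + 1` with `[k:ℚ] ≥ 2`). [cite: Gordon1999HodgeAVSurvey, 9.4.3] -/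
theorem not_isNondegenerate_of_shadow_eq_zero {i : I} (e : k →+* K i) (h2 : finrank ℚ (K i) = 2 * finrank ℚ k)
    (Φ : CMType (K i))
    (hzero : ∀ z : k →+* ℂ, 2 * (Finset.univ.filter fun φ : K i →+* ℂ => φ.comp e = z ∧ φ ∈ Φ.1).card =
      (Finset.univ.filter fun φ : K i →+* ℂ => φ.comp e = z).card) :
    ¬ IsNondegenerate Φ := by
  obtain ⟨S₁⟩ : Nonempty (CMType k) := CMTypeCount.nonempty_cmType_iff_isTotallyComplex.2 inferInstance
  have hb := cmTypeRank_add_finrank_div_two_le_of_fibres_balanced e (fibres_balanced_of_shadow_eq_zero e h2 Φ hzero) S₁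
  have hk : 2 ≤ finrank ℚ k := by
    have h := two_mul_card_filter_mem_cmType S₁
    have hpos : 0 < finrank ℚ k := finrank_pos
    omega
  rw [isNondegenerate_iff]
  omega

/-- **Quadratic steps: every family is degenerate beyond the capacity.**  If more than `[k:ℚ]/2` of the CM fields `K_i`
(`i ∈ S`) are QUADRATIC over the common CM field `k`, then EVERY family of CM types on `(K_i)` is degenerate — no
hypothesis on the types. [cite: Mai1989, §2 Prop. 1 (proof)] [cite: Gordon1999HodgeAVSurvey, 7.5–7.7 and 9.4.3] -/
theorem not_isNondegenerateFamily_of_card_lt_of_quadratic (e : ∀ i, k →+* K i) (Φ : ∀ i, CMType (K i))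
    (S : Finset I) (hS : finrank ℚ k / 2 < S.card) (h2 : ∀ i ∈ S, finrank ℚ (K i) = 2 * finrank ℚ k) :
    ¬ CMAlgebra.IsNondegenerateFamily Φ := by
  by_cases hne : ∀ i ∈ S, ∃ z : k →+* ℂ,
      2 * (Finset.univ.filter fun φ : K i →+* ℂ => φ.comp (e i) = z ∧ φ ∈ (Φ i).1).card ≠
        (Finset.univ.filter fun φ : K i →+* ℂ => φ.comp (e i) = z).card
  · exact not_isNondegenerateFamily_of_card_lt_of_shadows_ne_zero e Φ S hS hne
  · push Not at hne
    obtain ⟨i, hi, hzero⟩ := hne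
    intro hnd
    exact not_isNondegenerate_of_shadow_eq_zero (e i) (h2 i hi) (Φ i) hzero (hnd.isNondegenerate i)

end Quadratic

/-! ### §3 On abelian varieties: exceptional classes; three fourfolds over one quartic CM field -/

section Varieties

variable {Φ : ∀ i, CMType (K i)} {A : I → AbelianVariety ℂ} {ι : ∀ i, 𝓞 (K i) →+* End (A i)}
  {θ : ∀ i, K i →+* Module.End ℂ (complexBetti (A i).X 1)}

/-- **Beyond the capacity, simple non-isogenous realisations carry an exceptional Hodge class.**  If more than
`[k:ℚ]/2` of the CM fields are quadratic over the common CM field `k`, SIMPLE, pairwise NON-ISOGENOUS realisations of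
ANY types carry a rational `(m,m)`-class outside `Dᵐ ⊗ ℂ` on some `⨁_j A_{π j}` (not claimed algebraic or not).
[cite: Gordon1999HodgeAVSurvey, 7.4–7.7 and 9.4.3] -/
theorem exists_exceptional_prod_of_isSimple_of_card_lt_of_quadratic (e : ∀ i, k →+* K i) (S : Finset I)
    (hS : finrank ℚ k / 2 < S.card) (h2 : ∀ i ∈ S, finrank ℚ (K i) = 2 * finrank ℚ k)
    (hA : ∀ i, IsCMTypeRealisation (Φ i) (A i) (ι i) (θ i)) (hs : ∀ i, (A i).IsSimple)
    (hniso : ∀ i j, i ≠ j → ¬ AbelianVariety.IsIsogenous (A i) (A j)) :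
    ∃ (N : ℕ) (π : Fin N → I) (m : ℕ) (c : complexBetti (⨁ fun j : Fin N => A (π j)).X (2 * m)),
      IsRationalClass c ∧
      IsOfHodgeType (⨁ fun j : Fin N => A (π j)).dim (⨁ fun j : Fin N => A (π j)).X (2 * m) m m c ∧
      c ∉ divisorClassesSpan (⨁ fun j : Fin N => A (π j)).X (⨁ fun j : Fin N => A (π j)).dim m :=
  CMAlgebra.exists_exceptional_prod_of_not_isNondegenerateFamily
    (CMAlgebra.isSeparatingFamily_of_isSimple_of_pairwise_not_isIsogenous hA hs hniso)
    (not_isNondegenerateFamily_of_card_lt_of_quadratic e Φ S hS h2) hA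

/-- **`B• = D•` fails on some product** under the same hypotheses. [cite: Gordon1999HodgeAVSurvey, 7.5 and 7.6.1] -/
theorem not_forall_prod_hodgeClassSpan_eq_of_card_lt_of_quadratic (e : ∀ i, k →+* K i) (S : Finset I)
    (hS : finrank ℚ k / 2 < S.card) (h2 : ∀ i ∈ S, finrank ℚ (K i) = 2 * finrank ℚ k)
    (hA : ∀ i, IsCMTypeRealisation (Φ i) (A i) (ι i) (θ i)) (hs : ∀ i, (A i).IsSimple)
    (hniso : ∀ i j, i ≠ j → ¬ AbelianVariety.IsIsogenous (A i) (A j)) :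
    ¬ ∀ (N : ℕ) (π : Fin N → I) (m : ℕ),
      hodgeClassSpan (⨁ fun j : Fin N => A (π j)).dim (⨁ fun j : Fin N => A (π j)).X m =
        divisorClassesSpan (⨁ fun j : Fin N => A (π j)).X (⨁ fun j : Fin N => A (π j)).dim m := fun h =>
  not_isNondegenerateFamily_of_card_lt_of_quadratic e Φ S hS h2
    ((CMAlgebra.isNondegenerateFamily_iff_forall_prod_hodgeClassSpan_eq
      (CMAlgebra.isSeparatingFamily_of_isSimple_of_pairwise_not_isIsogenous hA hs hniso) hA).2 h)

/-- **Odd relative degrees beyond the capacity: simple non-isogenous realisations carry an exceptional Hodge class** on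
some product of powers, whatever the types. [cite: Gordon1999HodgeAVSurvey, 7.4–7.7] -/
theorem exists_exceptional_prod_of_isSimple_of_card_lt_of_odd (e : ∀ i, k →+* K i) (S : Finset I)
    (hS : finrank ℚ k / 2 < S.card) (hodd : ∀ i ∈ S, Odd (finrank ℚ (K i) / finrank ℚ k))
    (hA : ∀ i, IsCMTypeRealisation (Φ i) (A i) (ι i) (θ i)) (hs : ∀ i, (A i).IsSimple)
    (hniso : ∀ i j, i ≠ j → ¬ AbelianVariety.IsIsogenous (A i) (A j)) :
    ∃ (N : ℕ) (π : Fin N → I) (m : ℕ) (c : complexBetti (⨁ fun j : Fin N => A (π j)).X (2 * m)),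
      IsRationalClass c ∧
      IsOfHodgeType (⨁ fun j : Fin N => A (π j)).dim (⨁ fun j : Fin N => A (π j)).X (2 * m) m m c ∧
      c ∉ divisorClassesSpan (⨁ fun j : Fin N => A (π j)).X (⨁ fun j : Fin N => A (π j)).dim m :=
  CMAlgebra.exists_exceptional_prod_of_not_isNondegenerateFamily
    (CMAlgebra.isSeparatingFamily_of_isSimple_of_pairwise_not_isIsogenous hA hs hniso)
    (not_isNondegenerateFamily_of_card_lt_of_odd e Φ S hS hodd) hA

/-- **THREE simple, pairwise non-isogenous CM abelian FOURFOLDS whose octic CM fields contain a common QUARTIC CM field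
`k` always carry an exceptional Hodge class on some `F₀^a × F₁^b × F₂^c`** — whatever the fields and the types: the
capacity of a quartic CM field is `[k:ℚ]/2 = 2`.  (Here the family consists of CM fourfolds over `k`; `S` is any set of
at least three slots.) [cite: Gordon1999HodgeAVSurvey, 7.4–7.7 and 9.4.3] [cite: Mai1989, §2 Prop. 1 (proof)] -/
theorem exists_exceptional_prod_three_fourfolds_of_common_quartic (hk : finrank ℚ k = 4) (e : ∀ i, k →+* K i)
    (S : Finset I) (hS : 2 < S.card) (hd : ∀ i ∈ S, (A i).dim = 4)
    (hA : ∀ i, IsCMTypeRealisation (Φ i) (A i) (ι i) (θ i)) (hs : ∀ i, (A i).IsSimple)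
    (hniso : ∀ i j, i ≠ j → ¬ AbelianVariety.IsIsogenous (A i) (A j)) :
    ∃ (N : ℕ) (π : Fin N → I) (m : ℕ) (c : complexBetti (⨁ fun j : Fin N => A (π j)).X (2 * m)),
      IsRationalClass c ∧
      IsOfHodgeType (⨁ fun j : Fin N => A (π j)).dim (⨁ fun j : Fin N => A (π j)).X (2 * m) m m c ∧
      c ∉ divisorClassesSpan (⨁ fun j : Fin N => A (π j)).X (⨁ fun j : Fin N => A (π j)).dim m :=
  exists_exceptional_prod_of_isSimple_of_card_lt_of_quadratic e S (by rw [hk]; exact hS)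
    (fun i hi => by rw [finrank_eq_two_mul_dim_of_isCMTypeRealisation (hA i), hd i hi, hk]) hA hs hniso

/-- **`B• = D•` fails on some `F₀^a × F₁^b × F₂^c`** for three simple, pairwise non-isogenous CM fourfolds over a common
quartic CM field. [cite: Gordon1999HodgeAVSurvey, 7.5 and 7.6.1] -/
theorem not_forall_prod_hodgeClassSpan_eq_three_fourfolds_of_common_quartic (hk : finrank ℚ k = 4)
    (e : ∀ i, k →+* K i) (S : Finset I) (hS : 2 < S.card) (hd : ∀ i ∈ S, (A i).dim = 4)
    (hA : ∀ i, IsCMTypeRealisation (Φ i) (A i) (ι i) (θ i)) (hs : ∀ i, (A i).IsSimple)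
    (hniso : ∀ i j, i ≠ j → ¬ AbelianVariety.IsIsogenous (A i) (A j)) :
    ¬ ∀ (N : ℕ) (π : Fin N → I) (m : ℕ),
      hodgeClassSpan (⨁ fun j : Fin N => A (π j)).dim (⨁ fun j : Fin N => A (π j)).X m =
        divisorClassesSpan (⨁ fun j : Fin N => A (π j)).X (⨁ fun j : Fin N => A (π j)).dim m :=
  not_forall_prod_hodgeClassSpan_eq_of_card_lt_of_quadratic e S (by rw [hk]; exact hS)
    (fun i hi => by rw [finrank_eq_two_mul_dim_of_isCMTypeRealisation (hA i), hd i hi, hk]) hA hs hniso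

end Varieties

/-! ### §4 Mixed steps (appended): slots of odd relative degree OR quadratic over `k`; surfaces and fourfolds together -/

section Mixed

/-- **Mixed steps beyond the capacity: every family is degenerate.**  If more than `[k:ℚ]/2` of the CM fields `K_i`
(`i ∈ S`) are EITHER of odd relative degree over the common CM field `k` OR quadratic over it, EVERY family of CM types on
`(K_i)` is degenerate: a slot with zero shadow cannot have odd relative degree, so it is a quadratic step balanced over
`k` (Weil type, degenerate member); otherwise all shadows of `S` are non-zero and the capacity bound applies.
[cite: Mai1989, §2 Prop. 1 (proof)] [cite: Gordon1999HodgeAVSurvey, 7.5–7.7 and 9.4.3] -/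
theorem not_isNondegenerateFamily_of_card_lt_of_odd_or_quadratic (e : ∀ i, k →+* K i) (Φ : ∀ i, CMType (K i))
    (S : Finset I) (hS : finrank ℚ k / 2 < S.card)
    (h : ∀ i ∈ S, Odd (finrank ℚ (K i) / finrank ℚ k) ∨ finrank ℚ (K i) = 2 * finrank ℚ k) :
    ¬ CMAlgebra.IsNondegenerateFamily Φ := by
  by_cases hne : ∀ i ∈ S, ∃ z : k →+* ℂ,
      2 * (Finset.univ.filter fun φ : K i →+* ℂ => φ.comp (e i) = z ∧ φ ∈ (Φ i).1).card ≠
        (Finset.univ.filter fun φ : K i →+* ℂ => φ.comp (e i) = z).card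
  · exact not_isNondegenerateFamily_of_card_lt_of_shadows_ne_zero e Φ S hS hne
  · push Not at hne
    obtain ⟨i, hi, hzero⟩ := hne
    obtain ⟨z₀⟩ : Nonempty (k →+* ℂ) := inferInstance
    rcases h i hi with hodd | h2
    · exact absurd (hzero z₀) (two_mul_card_ne_card_of_odd (e i) hodd (Φ i) z₀)
    · intro hnd
      exact not_isNondegenerate_of_shadow_eq_zero (e i) h2 (Φ i) hzero (hnd.isNondegenerate i)

variable {Φ : ∀ i, CMType (K i)} {A : I → AbelianVariety ℂ} {ι : ∀ i, 𝓞 (K i) →+* End (A i)}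
  {θ : ∀ i, K i →+* Module.End ℂ (complexBetti (A i).X 1)}

/-- **Mixed steps beyond the capacity: simple non-isogenous realisations carry an exceptional Hodge class** on some
product of powers, whatever the types. [cite: Gordon1999HodgeAVSurvey, 7.4–7.7] -/
theorem exists_exceptional_prod_of_isSimple_of_card_lt_of_odd_or_quadratic (e : ∀ i, k →+* K i) (S : Finset I)
    (hS : finrank ℚ k / 2 < S.card)
    (h : ∀ i ∈ S, Odd (finrank ℚ (K i) / finrank ℚ k) ∨ finrank ℚ (K i) = 2 * finrank ℚ k)
    (hA : ∀ i, IsCMTypeRealisation (Φ i) (A i) (ι i) (θ i)) (hs : ∀ i, (A i).IsSimple)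
    (hniso : ∀ i j, i ≠ j → ¬ AbelianVariety.IsIsogenous (A i) (A j)) :
    ∃ (N : ℕ) (π : Fin N → I) (m : ℕ) (c : complexBetti (⨁ fun j : Fin N => A (π j)).X (2 * m)),
      IsRationalClass c ∧
      IsOfHodgeType (⨁ fun j : Fin N => A (π j)).dim (⨁ fun j : Fin N => A (π j)).X (2 * m) m m c ∧
      c ∉ divisorClassesSpan (⨁ fun j : Fin N => A (π j)).X (⨁ fun j : Fin N => A (π j)).dim m :=
  CMAlgebra.exists_exceptional_prod_of_not_isNondegenerateFamily
    (CMAlgebra.isSeparatingFamily_of_isSimple_of_pairwise_not_isIsogenous hA hs hniso)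
    (not_isNondegenerateFamily_of_card_lt_of_odd_or_quadratic e Φ S hS h) hA

/-- **Any THREE simple, pairwise non-isogenous CM abelian varieties of dimensions 2 or 4 whose CM fields contain a
common QUARTIC CM field `k` carry an exceptional Hodge class on some product of their powers** — a CM surface has CM
field `≅ k` (relative degree `1`, odd), a CM fourfold an octic field quadratic over `k`; capacity `[k:ℚ]/2 = 2`.  E.g.
`S × F₀ × F₁` for a simple CM surface `S` with quartic field `k` and two simple CM fourfolds whose fields contain `k`
(whereas `S × F` alone is nondegenerate iff `F` is, for `k ⊂ K_F` non-Galois: `QuarticCMSubfieldOfOcticHodge`).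
[cite: Gordon1999HodgeAVSurvey, 7.4–7.7 and 9.4.3] [cite: MoonenZarhin1999LowDim, "Hodge groups of simple abelian surfaces of CM-type"] -/
theorem exists_exceptional_prod_three_surfaces_or_fourfolds_of_common_quartic (hk : finrank ℚ k = 4)
    (e : ∀ i, k →+* K i) (S : Finset I) (hS : 2 < S.card) (hd : ∀ i ∈ S, (A i).dim = 2 ∨ (A i).dim = 4)
    (hA : ∀ i, IsCMTypeRealisation (Φ i) (A i) (ι i) (θ i)) (hs : ∀ i, (A i).IsSimple)
    (hniso : ∀ i j, i ≠ j → ¬ AbelianVariety.IsIsogenous (A i) (A j)) :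
    ∃ (N : ℕ) (π : Fin N → I) (m : ℕ) (c : complexBetti (⨁ fun j : Fin N => A (π j)).X (2 * m)),
      IsRationalClass c ∧
      IsOfHodgeType (⨁ fun j : Fin N => A (π j)).dim (⨁ fun j : Fin N => A (π j)).X (2 * m) m m c ∧
      c ∉ divisorClassesSpan (⨁ fun j : Fin N => A (π j)).X (⨁ fun j : Fin N => A (π j)).dim m := by
  refine exists_exceptional_prod_of_isSimple_of_card_lt_of_odd_or_quadratic e S (by rw [hk]; exact hS)
    (fun i hi => ?_) hA hs hniso
  rcases hd i hi with h2 | h4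
  · left
    rw [finrank_eq_two_mul_dim_of_isCMTypeRealisation (hA i), h2, hk]
    exact ⟨0, rfl⟩
  · right
    rw [finrank_eq_two_mul_dim_of_isCMTypeRealisation (hA i), h4, hk]

end Mixed

end Summit.HodgeConjecture.CorCM

end
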